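import Mathlib.Analysis.Complex.CauchyIntegral
import Mathlib.Analysis.Complex.Liouville
import Mathlib.Analysis.Complex.TaylorSeries
import Mathlib.Analysis.Calculus.ParametricIntervalIntegral
import Mathlib.Analysis.Calculus.MeanValue
import Mathlib.Analysis.Calculus.ContDiff.FiniteDimension
import Mathlib.Analysis.Calculus.InverseFunctionTheorem.ContDiff
import Mathlib.LinearAlgebra.Projection
import Mathlib.Topology.Algebra.Module.FiniteDimension
import HarnessLib

/-!
# Holomorphic functions of several complex variables: basic regularity

Mathlib (at the pin of this tree) proves that a complex-differentiable function of *one* complex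
variable is analytic (`DifferentiableOn.analyticAt`, Cauchy integral formula), but has no
several-variable analogue (no Osgood/Hartogs lemma, no polydisc Cauchy formula). This file supplies
the part of the several-variable theory needed for the local geometry of analytic sets
(`Literature/Geometry/Kaehler/AnalyticSet.lean`), for `f : E → F` complex-(Fréchet-)differentiable
on an open set `U` of a complex normed space `E`, with `F` complete:

* `Literature.Analysis.Complex.SCV.fderiv_apply_eq_smul_circleIntegral`: Cauchy formula for a directional derivative,
  `∂_v f (x) = (2πi)⁻¹ ∮_{|z|=r} z⁻² f (x + z v) dz` (slice along the complex line `x + ℂ v`);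
* `Literature.Analysis.Complex.SCV.norm_fderiv_apply_le`, `Literature.Analysis.Complex.SCV.exists_ball_norm_fderiv_le`: Cauchy estimate, local
  boundedness of `fderiv`, local Lipschitz bounds;
* `Literature.Analysis.Complex.SCV.continuousOn_fderiv`, `Literature.Analysis.Complex.SCV.contDiffOn_one`: **holomorphic ⇒ `C¹`** (any `E`);
* `Literature.Analysis.Complex.SCV.differentiableOn_fderiv_apply`: **directional derivatives of holomorphic functions are
  holomorphic** (differentiation under the integral sign), hence
  `Literature.Analysis.Complex.SCV.contDiffOn_nat` / `Literature.Analysis.Complex.SCV.contDiffOn_infty`: **holomorphic ⇒ `C^∞`** (`E`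
  finite-dimensional) — the `C^∞` half of Osgood's lemma;
* `Literature.Analysis.Complex.SCV.eqOn_zero_ball_of_iterate_fderiv_apply_eq_zero` and corollaries: the **identity
  principle** in the form "if all iterated directional derivatives `∂_v^k f (x)` vanish then
  `f ≡ 0` near `x`" (one-variable Taylor expansion along complex lines);
* `Literature.Analysis.Complex.SCV.exists_straightening`: the **holomorphic implicit function theorem** in straightening
  form — a holomorphic `g : E → G` with `(dg(a), ψ) : E ≃ G × K` bijective is, near `a`, the first
  component of a biholomorphism `Φ = (g, ψ(· - a))` onto an open subset of `G × K` (real-`C¹`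
  inverse function theorem of Mathlib over `𝕂 = ℂ` plus `contDiffOn_one`).

## References

* W. F. Osgood, *Note über analytische Functionen mehrerer Veränderlichen*, Math. Ann. 52 (1899).
* R. C. Gunning, H. Rossi, *Analytic Functions of Several Complex Variables* (1965), Ch. I §A.
* E. M. Chirka, *Complex Analytic Sets* (1989), Appendix A1.1 (holomorphic functions in `ℂⁿ`,
  uniqueness theorem) and A2.2 (implicit function and rank theorems) [Chirka1989].

## Design notes

Directional derivatives are written `fderiv ℂ f x v`; the operator `∂_v` is the lambda
`(fderiv ℂ · · v)` so that iterates are `(fderiv ℂ · · v)^[k] f` (no new definitions: this file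
is theorems only). All statements are about `DifferentiableOn ℂ f U` with `U` open, the form in
which local defining functions of analytic sets are given.
-/

open Complex Metric Set Filter
open scoped Topology Real ContDiff

namespace Literature.Analysis.Complex
namespace SCV

variable {E : Type*} [NormedAddCommGroup E] [NormedSpace ℂ E]
  {F : Type*} [NormedAddCommGroup F] [NormedSpace ℂ F]

/-! ### Complex line slices -/

/-- The complex-line slice `t ↦ f (x + t • v)` of a function complex-differentiable on `U` is
complex-differentiable on the set of parameters `t` with `x + t • v ∈ U`. [folklore] -/
theorem differentiableOn_slice {f : E → F} {U : Set E} (hf : DifferentiableOn ℂ f U) (x v : E) :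
    DifferentiableOn ℂ (fun t : ℂ => f (x + t • v)) {t | x + t • v ∈ U} :=
  hf.comp (by fun_prop) fun _ ht => ht

/-- The parameter set of a slice of an open set is open. [folklore] -/
theorem isOpen_slice {U : Set E} (hU : IsOpen U) (x v : E) : IsOpen {t : ℂ | x + t • v ∈ U} :=
  hU.preimage (by fun_prop)

/-- Chain rule along a complex line: the derivative of `s ↦ f (x + s • v)` at `t` is the
directional derivative `fderiv ℂ f (x + t • v) v`. [folklore] -/
theorem hasDerivAt_slice {f : E → F} {x v : E} {t : ℂ} (hf : DifferentiableAt ℂ f (x + t • v)) :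
    HasDerivAt (fun s : ℂ => f (x + s • v)) (fderiv ℂ f (x + t • v) v) t := by
  have h1 : HasDerivAt (fun s : ℂ => x + s • v) v t := by
    simpa using ((hasDerivAt_id t).smul_const v).const_add x
  exact hf.hasFDerivAt.comp_hasDerivAt t h1

/-- Chain rule along a complex line at the base point. [folklore] -/
theorem hasDerivAt_slice_zero {f : E → F} {x : E} (hf : DifferentiableAt ℂ f x) (v : E) :
    HasDerivAt (fun s : ℂ => f (x + s • v)) (fderiv ℂ f x v) 0 := by
  have hf' : DifferentiableAt ℂ f (x + (0 : ℂ) • v) := by simp [hf]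
  simpa using hasDerivAt_slice hf'

/-! ### Cauchy formula and Cauchy estimate for directional derivatives -/

section Cauchy

variable [CompleteSpace F]

/-- **Cauchy formula for a directional derivative** of a function of several complex variables:
if `f` is complex-differentiable on an open set containing the closed complex disc
`{x + t • v | ‖t‖ ≤ r}`, then `∂_v f (x) = (2πi)⁻¹ ∮_{|z|=r} z⁻² f(x + z v) dz`.
[Chirka, *Complex Analytic Sets*, A1.1] [folklore] -/
theorem fderiv_apply_eq_smul_circleIntegral {f : E → F} {U : Set E} (hf : DifferentiableOn ℂ f U)
    (hU : IsOpen U) {x v : E} {r : ℝ} (hr : 0 < r)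
    (hsub : ∀ t ∈ closedBall (0 : ℂ) r, x + t • v ∈ U) :
    fderiv ℂ f x v = (2 * π * I)⁻¹ • ∮ z in C(0, r), (1 / z ^ 2) • f (x + z • v) := by
  have hd : DifferentiableOn ℂ (fun t : ℂ => f (x + t • v)) (closedBall 0 r) :=
    (differentiableOn_slice hf x v).mono hsub
  have hx : x ∈ U := by simpa using hsub 0 (mem_closedBall_self hr.le)
  have key := hd.deriv_eq_smul_circleIntegral hr
  simp only [sub_zero] at key
  rw [key, (hasDerivAt_slice_zero (hf.differentiableAt (hU.mem_nhds hx)) v).deriv,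
    inv_smul_smul₀]
  simp [Real.pi_ne_zero, I_ne_zero]

end Cauchy

/-- **Cauchy estimate for a directional derivative**: if `f` is complex-differentiable on an open
set containing the closed complex disc `{x + t • v | ‖t‖ ≤ r}` and `‖f‖ ≤ C` on its boundary
circle, then `‖∂_v f (x)‖ ≤ C / r`. [Chirka, *Complex Analytic Sets*, A1.1] [folklore] -/
theorem norm_fderiv_apply_le {f : E → F} {U : Set E} (hf : DifferentiableOn ℂ f U) (hU : IsOpen U)
    {x v : E} {r C : ℝ} (hr : 0 < r) (hsub : ∀ t ∈ closedBall (0 : ℂ) r, x + t • v ∈ U)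
    (hC : ∀ t ∈ sphere (0 : ℂ) r, ‖f (x + t • v)‖ ≤ C) : ‖fderiv ℂ f x v‖ ≤ C / r := by
  have hd : DifferentiableOn ℂ (fun t : ℂ => f (x + t • v)) (closedBall 0 r) :=
    (differentiableOn_slice hf x v).mono hsub
  have hx : x ∈ U := by simpa using hsub 0 (mem_closedBall_self hr.le)
  rw [← (hasDerivAt_slice_zero (hf.differentiableAt (hU.mem_nhds hx)) v).deriv]
  refine norm_deriv_le_of_forall_mem_sphere_norm_le hr ?_ hC
  exact (hd.mono (by rw [closure_ball _ hr.ne'])).diffContOnCl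

/-- The Fréchet derivative of a complex-differentiable function of several variables is locally
bounded (from the Cauchy estimates; no finite-dimensionality needed). [folklore] -/
theorem exists_ball_norm_fderiv_le {f : E → F} {U : Set E} (hf : DifferentiableOn ℂ f U)
    (hU : IsOpen U) {x₀ : E} (hx₀ : x₀ ∈ U) :
    ∃ ε > 0, ∃ K ≥ (0 : ℝ), ball x₀ ε ⊆ U ∧ ∀ y ∈ ball x₀ ε, ‖fderiv ℂ f y‖ ≤ K := by
  obtain ⟨δ, hδ, hδU⟩ := Metric.isOpen_iff.1 hU x₀ hx₀
  have hcont : ContinuousAt f x₀ := (hf.differentiableAt (hU.mem_nhds hx₀)).continuousAt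
  obtain ⟨δ', hδ', hC⟩ : ∃ δ' > 0, ∀ y ∈ ball x₀ δ', ‖f y‖ ≤ ‖f x₀‖ + 1 := by
    obtain ⟨δ', hδ', h⟩ := Metric.continuousAt_iff.1 hcont 1 one_pos
    refine ⟨δ', hδ', fun y hy => ?_⟩
    have h1 : dist (f y) (f x₀) < 1 := h hy
    rw [dist_eq_norm] at h1
    linarith [norm_le_insert' (f y) (f x₀), norm_sub_rev (f y) (f x₀)]
  set ρ := min δ δ' with hρ_def
  have hρ : 0 < ρ := lt_min hδ hδ'
  set C := ‖f x₀‖ + 1 with hC_def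
  have hC0 : 0 ≤ C := by positivity
  refine ⟨ρ / 2, half_pos hρ, 4 * C / ρ, by positivity, ?_, fun y hy => ?_⟩
  · exact (ball_subset_ball (by linarith [min_le_left δ δ'])).trans hδU
  refine ContinuousLinearMap.opNorm_le_bound _ (by positivity) fun v => ?_
  rcases eq_or_ne v 0 with rfl | hv
  · simp
  have hv' : 0 < ‖v‖ := norm_pos_iff.2 hv
  set r := ρ / (4 * ‖v‖) with hr_def
  have hr : 0 < r := by positivity
  -- points of the closed disc of radius `r` in direction `v` around `y` stay in `ball x₀ ρ`
  have hmem : ∀ t ∈ closedBall (0 : ℂ) r, y + t • v ∈ ball x₀ ρ := by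
    intro t ht
    rw [mem_closedBall, dist_zero_right] at ht
    rw [mem_ball] at hy ⊢
    have h1 : ‖t • v‖ ≤ ρ / 4 := by
      rw [norm_smul]
      calc ‖t‖ * ‖v‖ ≤ r * ‖v‖ := by gcongr
        _ = ρ / 4 := by rw [hr_def]; field_simp
    calc dist (y + t • v) x₀ ≤ dist (y + t • v) y + dist y x₀ := dist_triangle _ _ _
      _ = ‖t • v‖ + dist y x₀ := by rw [dist_eq_norm, add_sub_cancel_left]
      _ < ρ / 4 + ρ / 2 := by linarith
      _ ≤ ρ := by linarith
  have hballU : ball x₀ ρ ⊆ U := (ball_subset_ball (min_le_left δ δ')).trans hδU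
  have key := norm_fderiv_apply_le hf hU hr (fun t ht => hballU (hmem t ht)) (C := C)
    (fun t ht => hC _ (ball_subset_ball (min_le_right δ δ') (hmem t (sphere_subset_closedBall ht))))
  calc ‖fderiv ℂ f y v‖ ≤ C / r := key
    _ = 4 * C / ρ * ‖v‖ := by rw [hr_def]; field_simp

/-- A complex-differentiable function of several variables is locally Lipschitz. [folklore] -/
theorem exists_ball_lipschitzOnWith {f : E → F} {U : Set E} (hf : DifferentiableOn ℂ f U)
    (hU : IsOpen U) {x₀ : E} (hx₀ : x₀ ∈ U) :
    ∃ ε > 0, ∃ K ≥ (0 : ℝ), ball x₀ ε ⊆ U ∧ (∀ y ∈ ball x₀ ε, ‖fderiv ℂ f y‖ ≤ K) ∧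
      ∀ y ∈ ball x₀ ε, ∀ y' ∈ ball x₀ ε, ‖f y - f y'‖ ≤ K * ‖y - y'‖ := by
  obtain ⟨ε, hε, K, hK, hεU, hb⟩ := exists_ball_norm_fderiv_le hf hU hx₀
  refine ⟨ε, hε, K, hK, hεU, hb, fun y hy y' hy' => ?_⟩
  exact (convex_ball x₀ ε).norm_image_sub_le_of_norm_fderiv_le (𝕜 := ℂ)
    (fun z hz => hf.differentiableAt (hU.mem_nhds (hεU hz))) hb hy' hy

/-- Operator-norm bound from a bound on the closed unit ball (complex scalars). [folklore] -/
theorem opNorm_le_of_unit_ball {G : Type*} [NormedAddCommGroup G] [NormedSpace ℂ G]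
    (L : E →L[ℂ] G) {C : ℝ} (hC : 0 ≤ C) (h : ∀ v, ‖v‖ ≤ 1 → ‖L v‖ ≤ C) : ‖L‖ ≤ C := by
  refine ContinuousLinearMap.opNorm_le_bound _ hC fun v => ?_
  rcases eq_or_ne v 0 with rfl | hv
  · simp
  have hv' : 0 < ‖v‖ := norm_pos_iff.2 hv
  have h1 : ‖((‖v‖⁻¹ : ℂ)) • v‖ ≤ 1 := by
    rw [norm_smul, norm_inv, Complex.norm_real, Real.norm_eq_abs, abs_of_pos hv',
      inv_mul_cancel₀ hv'.ne']
  have h2 := h _ h1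
  rw [map_smul, norm_smul, norm_inv, Complex.norm_real, Real.norm_eq_abs, abs_of_pos hv'] at h2
  rwa [inv_mul_le_iff₀ hv', mul_comm] at h2

section Cauchy

variable [CompleteSpace F]

/-- Continuity of the Cauchy integrand
`θ ↦ (circleMap 0 r θ * I) • (circleMap 0 r θ)⁻² • g (y + circleMap 0 r θ • v)`
for `g` continuous on a set containing the circle. [folklore] -/
theorem continuous_cauchyIntegrand {G : Type*} [NormedAddCommGroup G] [NormedSpace ℂ G]
    {g : E → G} {U : Set E} (hg : ContinuousOn g U) {y v : E} {r : ℝ} (hr : 0 < r)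
    (hmem : ∀ t ∈ closedBall (0 : ℂ) r, y + t • v ∈ U) :
    Continuous fun θ : ℝ => deriv (circleMap 0 r) θ •
      ((1 / circleMap 0 r θ ^ 2) • g (y + circleMap 0 r θ • v)) := by
  simp only [deriv_circleMap]
  refine ((continuous_circleMap 0 r).mul continuous_const).smul
    ((continuous_const.div ((continuous_circleMap 0 r).pow 2) fun θ => ?_).smul ?_)
  · exact pow_ne_zero _ (circleMap_ne_center hr.ne')
  · exact hg.comp_continuous (by fun_prop)
      fun θ => hmem _ (circleMap_mem_closedBall _ hr.le θ)

/-- The Fréchet derivative of a complex-differentiable function of several variables is locally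
Lipschitz, hence continuous: **holomorphic functions are `C¹`** (any normed domain, complete
codomain). [Osgood 1899; Chirka, *Complex Analytic Sets*, A1.1] [folklore] -/
theorem continuousOn_fderiv {f : E → F} {U : Set E} (hf : DifferentiableOn ℂ f U)
    (hU : IsOpen U) : ContinuousOn (fderiv ℂ f) U := by
  intro x₀ hx₀
  obtain ⟨ε, hε, K, hK, hεU, -, hlip⟩ := exists_ball_lipschitzOnWith hf hU hx₀
  -- Lipschitz estimate for `fderiv` on `ball x₀ (ε / 2)`
  set r : ℝ := ε / 4 with hr_def
  have hr : 0 < r := by positivity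
  have hmem : ∀ y ∈ ball x₀ (ε / 2), ∀ t ∈ closedBall (0 : ℂ) r, ∀ v : E, ‖v‖ ≤ 1 →
      y + t • v ∈ ball x₀ ε := by
    intro y hy t ht v hv
    rw [mem_closedBall, dist_zero_right] at ht
    rw [mem_ball] at hy ⊢
    have h1 : ‖t • v‖ ≤ ε / 4 := by
      rw [norm_smul]
      calc ‖t‖ * ‖v‖ ≤ r * 1 := by gcongr
        _ = ε / 4 := by rw [hr_def, mul_one]
    calc dist (y + t • v) x₀ ≤ dist (y + t • v) y + dist y x₀ := dist_triangle _ _ _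
      _ = ‖t • v‖ + dist y x₀ := by rw [dist_eq_norm, add_sub_cancel_left]
      _ < ε / 4 + ε / 2 := by linarith
      _ ≤ ε := by linarith
  have hest : ∀ y ∈ ball x₀ (ε / 2), ∀ y' ∈ ball x₀ (ε / 2),
      ‖fderiv ℂ f y - fderiv ℂ f y'‖ ≤ K / r * ‖y - y'‖ := by
    intro y hy y' hy'
    refine opNorm_le_of_unit_ball _ (by positivity) fun v hv => ?_
    have hI : ∀ w ∈ ball x₀ (ε / 2),
        CircleIntegrable (fun z : ℂ => (1 / z ^ 2) • f (w + z • v)) 0 r := by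
      intro w hw
      refine ContinuousOn.circleIntegrable hr.le ?_
      refine (continuousOn_const.div (continuousOn_pow 2) fun z hz => ?_).smul ?_
      · refine pow_ne_zero _ ?_
        rintro rfl
        simp [hr.ne] at hz
      · exact hf.continuousOn.comp (by fun_prop)
          fun z hz => hεU (hmem w hw z (sphere_subset_closedBall hz) v hv)
    rw [sub_apply,
      fderiv_apply_eq_smul_circleIntegral hf hU hr (fun t ht => hεU (hmem y hy t ht v hv)),
      fderiv_apply_eq_smul_circleIntegral hf hU hr (fun t ht => hεU (hmem y' hy' t ht v hv)),
      ← smul_sub, ← circleIntegral.integral_sub (hI y hy) (hI y' hy'), norm_smul]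
    have hb : ∀ z ∈ sphere (0 : ℂ) |r|,
        ‖(1 / z ^ 2) • f (y + z • v) - (1 / z ^ 2) • f (y' + z • v)‖ ≤
          (r ^ 2)⁻¹ * (K * ‖y - y'‖) := by
      intro z hz
      rw [abs_of_pos hr] at hz
      have hz' : ‖z‖ = r := by simpa using hz
      rw [← smul_sub, norm_smul]
      gcongr
      · simp [hz']
      · have := hlip _ (hmem y hy z (sphere_subset_closedBall hz) v hv) _
          (hmem y' hy' z (sphere_subset_closedBall hz) v hv)
        simpa [add_sub_add_right_eq_sub] using this
    calc ‖(2 * π * I)⁻¹‖ * ‖∮ z in C(0, r), ((1 / z ^ 2) • f (y + z • v) -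
            (1 / z ^ 2) • f (y' + z • v))‖
        ≤ ‖(2 * π * I)⁻¹‖ * (2 * π * |r| * ((r ^ 2)⁻¹ * (K * ‖y - y'‖))) := by
          gcongr
          exact circleIntegral.norm_integral_le_of_norm_le_const' hb
      _ = K / r * ‖y - y'‖ := by
          rw [abs_of_pos hr]
          simp only [norm_inv, norm_mul, Complex.norm_ofNat, Complex.norm_real, Real.norm_eq_abs,
            abs_of_pos Real.pi_pos, Complex.norm_I, mul_one]
          field_simp
  -- continuity within `U` at `x₀`
  have hcont : ContinuousOn (fderiv ℂ f) (ball x₀ (ε / 2)) := by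
    have : LipschitzOnWith (Real.toNNReal (K / r)) (fderiv ℂ f) (ball x₀ (ε / 2)) := by
      refine LipschitzOnWith.of_dist_le_mul fun y hy y' hy' => ?_
      rw [dist_eq_norm, dist_eq_norm, Real.coe_toNNReal _ (by positivity)]
      exact hest y hy y' hy'
    exact this.continuousOn
  exact (hcont.continuousAt (ball_mem_nhds x₀ (half_pos hε))).continuousWithinAt

/-- **Holomorphic functions of several variables are `C¹`.** [Osgood 1899] [folklore] -/
theorem contDiffOn_one {f : E → F} {U : Set E} (hf : DifferentiableOn ℂ f U) (hU : IsOpen U) :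
    ContDiffOn ℂ 1 f U := by
  rw [show (1 : WithTop ℕ∞) = 0 + 1 from rfl, contDiffOn_succ_iff_fderiv_of_isOpen hU]
  exact ⟨hf, fun h => by simp at h, contDiffOn_zero.2 (continuousOn_fderiv hf hU)⟩

/-- **Directional derivatives of holomorphic functions are holomorphic**: if `f` is
complex-differentiable on an open set `U`, then so is `y ↦ ∂_v f (y) = fderiv ℂ f y v`
(differentiation under the integral sign in the Cauchy formula).
[Osgood 1899; Chirka, *Complex Analytic Sets*, A1.1] [folklore] -/
theorem differentiableOn_fderiv_apply {f : E → F} {U : Set E} (hf : DifferentiableOn ℂ f U)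
    (hU : IsOpen U) (v : E) : DifferentiableOn ℂ (fun y => fderiv ℂ f y v) U := by
  intro x₀ hx₀
  suffices h : DifferentiableAt ℂ (fun y => fderiv ℂ f y v) x₀ from h.differentiableWithinAt
  obtain ⟨ε, hε, K, hK, hεU, hbound⟩ := exists_ball_norm_fderiv_le hf hU hx₀
  set r : ℝ := ε / (4 * (‖v‖ + 1)) with hr_def
  have hr : 0 < r := by positivity
  have hmem : ∀ y ∈ ball x₀ (ε / 2), ∀ t ∈ closedBall (0 : ℂ) r, y + t • v ∈ ball x₀ ε := by
    intro y hy t ht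
    rw [mem_closedBall, dist_zero_right] at ht
    rw [mem_ball] at hy ⊢
    have h1 : ‖t • v‖ ≤ ε / 4 := by
      rw [norm_smul]
      calc ‖t‖ * ‖v‖ ≤ r * ‖v‖ := by gcongr
        _ = ε / 4 * (‖v‖ / (‖v‖ + 1)) := by rw [hr_def]; field_simp
        _ ≤ ε / 4 * 1 := by
          gcongr
          rw [div_le_one (by positivity)]
          linarith
        _ = ε / 4 := mul_one _
    calc dist (y + t • v) x₀ ≤ dist (y + t • v) y + dist y x₀ := dist_triangle _ _ _
      _ = ‖t • v‖ + dist y x₀ := by rw [dist_eq_norm, add_sub_cancel_left]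
      _ < ε / 4 + ε / 2 := by linarith
      _ ≤ ε := by linarith
  -- the Cauchy integrand and its derivative in the parameter `y`
  set G : E → ℝ → F := fun y θ => deriv (circleMap 0 r) θ •
    ((1 / circleMap 0 r θ ^ 2) • f (y + circleMap 0 r θ • v)) with hG_def
  set G' : E → ℝ → (E →L[ℂ] F) := fun y θ => deriv (circleMap 0 r) θ •
    ((1 / circleMap 0 r θ ^ 2) • fderiv ℂ f (y + circleMap 0 r θ • v)) with hG'_def
  have hGc : ∀ y ∈ ball x₀ (ε / 2), Continuous (G y) := fun y hy =>
    continuous_cauchyIntegrand hf.continuousOn hr fun t ht => hεU (hmem y hy t ht)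
  have hG'c : Continuous (G' x₀) :=
    continuous_cauchyIntegrand (continuousOn_fderiv hf hU) hr
      fun t ht => hεU (hmem x₀ (mem_ball_self (half_pos hε)) t ht)
  have hderiv : HasFDerivAt (fun y => ∫ θ in (0 : ℝ)..2 * π, G y θ)
      (∫ θ in (0 : ℝ)..2 * π, G' x₀ θ) x₀ := by
    refine intervalIntegral.hasFDerivAt_integral_of_dominated_of_fderiv_le (𝕜 := ℂ)
      (bound := fun _ => |r| * (r ^ 2)⁻¹ * K) (ball_mem_nhds x₀ (half_pos hε)) ?_ ?_ ?_ ?_ ?_ ?_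
    · filter_upwards [ball_mem_nhds x₀ (half_pos hε)] with y hy
      exact (hGc y hy).aestronglyMeasurable
    · exact (hGc x₀ (mem_ball_self (half_pos hε))).intervalIntegrable _ _
    · exact hG'c.aestronglyMeasurable
    · refine Eventually.of_forall fun θ _ y hy => ?_
      have hn : ‖G' y θ‖ = |r| * (r ^ 2)⁻¹ * ‖fderiv ℂ f (y + circleMap 0 r θ • v)‖ := by
        simp only [hG'_def, deriv_circleMap, norm_smul, norm_mul, Complex.norm_I, mul_one, one_div,
          norm_inv, norm_pow, norm_circleMap_zero, sq_abs, mul_assoc]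
      rw [hn]
      gcongr
      exact hbound _ (hmem y hy _ (circleMap_mem_closedBall _ hr.le θ))
    · exact intervalIntegrable_const
    · refine Eventually.of_forall fun θ _ y hy => ?_
      have hd : DifferentiableAt ℂ f (y + circleMap 0 r θ • v) :=
        hf.differentiableAt (hU.mem_nhds (hεU (hmem y hy _ (circleMap_mem_closedBall _ hr.le θ))))
      have h1 : HasFDerivAt (fun y : E => f (y + circleMap 0 r θ • v))
          (fderiv ℂ f (y + circleMap 0 r θ • v)) y := by
        simpa [Function.comp_def] using
          hd.hasFDerivAt.comp y ((hasFDerivAt_id y).add_const (circleMap 0 r θ • v))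
      exact (h1.const_smul (1 / circleMap 0 r θ ^ 2)).const_smul (deriv (circleMap 0 r) θ)
  have heq : (fun y => (2 * π * I)⁻¹ • ∫ θ in (0 : ℝ)..2 * π, G y θ) =ᶠ[𝓝 x₀]
      fun y => fderiv ℂ f y v := by
    filter_upwards [ball_mem_nhds x₀ (half_pos hε)] with y hy
    rw [fderiv_apply_eq_smul_circleIntegral hf hU hr (fun t ht => hεU (hmem y hy t ht))]
    rfl
  exact ((hderiv.const_smul ((2 * π * I)⁻¹)).congr_of_eventuallyEq heq.symm).differentiableAt

/-- **Holomorphic functions of several variables are `C^n` for every finite `n`** (finite-dimensional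
domain, complete codomain). [Osgood 1899; Chirka, *Complex Analytic Sets*, A1.1] [folklore] -/
theorem contDiffOn_nat [FiniteDimensional ℂ E] {f : E → F} {U : Set E}
    (hf : DifferentiableOn ℂ f U) (hU : IsOpen U) (n : ℕ) : ContDiffOn ℂ n f U := by
  induction n generalizing f with
  | zero => exact contDiffOn_zero.2 hf.continuousOn
  | succ n ih =>
    rw [Nat.cast_succ, contDiffOn_succ_iff_fderiv_apply hU.uniqueDiffOn]
    refine ⟨hf, fun h => ?_, fun v => ?_⟩
    · exact absurd h (by simp)
    · refine (ih (differentiableOn_fderiv_apply hf hU v)).congr fun y hy => ?_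
      rw [fderivWithin_of_isOpen hU hy]

/-- **Holomorphic functions of several variables are `C^∞`.** [Osgood 1899] [folklore] -/
theorem contDiffOn_infty [FiniteDimensional ℂ E] {f : E → F} {U : Set E}
    (hf : DifferentiableOn ℂ f U) (hU : IsOpen U) : ContDiffOn ℂ ∞ f U :=
  _root_.contDiffOn_infty.2 fun n => contDiffOn_nat hf hU n

end Cauchy

/-! ### Identity principle: vanishing of all iterated directional derivatives

We write the directional-derivative operator `∂_v : (E → F) → (E → F)`,
`∂_v g (y) = fderiv ℂ g y v`, as the lambda `(fderiv ℂ · · v)`, so that `∂_v^k f = (fderiv ℂ · · v)^[k] f`. -/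

section Cauchy

variable [CompleteSpace F]

/-- Iterated directional derivatives of a holomorphic function are holomorphic. [folklore] -/
theorem differentiableOn_iterate_fderiv_apply {f : E → F} {U : Set E} (hf : DifferentiableOn ℂ f U)
    (hU : IsOpen U) (v : E) (k : ℕ) : DifferentiableOn ℂ ((fderiv ℂ · · v)^[k] f) U := by
  induction k with
  | zero => simpa using hf
  | succ k ih =>
    rw [Function.iterate_succ_apply']
    exact differentiableOn_fderiv_apply ih hU v

/-- Along a complex line inside `U`, the `k`-th derivative of the slice `t ↦ f (x + t • v)` is the
slice of the `k`-th iterated directional derivative `∂_v^k f`. [folklore] -/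
theorem iteratedDeriv_slice_eqOn {f : E → F} {U : Set E} (hf : DifferentiableOn ℂ f U)
    (hU : IsOpen U) (x v : E) (k : ℕ) :
    EqOn (iteratedDeriv k fun t : ℂ => f (x + t • v))
      (fun t => ((fderiv ℂ · · v)^[k] f) (x + t • v)) {t | x + t • v ∈ U} := by
  induction k with
  | zero => intro t _; simp
  | succ k ih =>
    intro t ht
    rw [iteratedDeriv_succ, Function.iterate_succ_apply']
    have hev : iteratedDeriv k (fun t : ℂ => f (x + t • v)) =ᶠ[𝓝 t]
        fun t => ((fderiv ℂ · · v)^[k] f) (x + t • v) :=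
      eventuallyEq_of_mem ((isOpen_slice hU x v).mem_nhds ht) ih
    rw [hev.deriv_eq]
    have hd : DifferentiableAt ℂ ((fderiv ℂ · · v)^[k] f) (x + t • v) :=
      (differentiableOn_iterate_fderiv_apply hf hU v k).differentiableAt (hU.mem_nhds ht)
    exact (hasDerivAt_slice hd).deriv

/-- **Identity principle (infinite-order vanishing).** If `f` is complex-differentiable on an open
set `U ⊇ ball x ρ` and all iterated directional derivatives `∂_v^k f (x)` (`v ∈ E`, `k ∈ ℕ`)
vanish, then `f` vanishes on `ball x ρ` (restrict to complex lines through `x` and use the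
one-variable Taylor expansion). [Chirka, *Complex Analytic Sets*, A1.1] [folklore] -/
theorem eqOn_zero_ball_of_iterate_fderiv_apply_eq_zero {f : E → F} {U : Set E}
    (hf : DifferentiableOn ℂ f U) (hU : IsOpen U) {x : E} {ρ : ℝ} (hρU : ball x ρ ⊆ U)
    (h : ∀ (v : E) (k : ℕ), ((fderiv ℂ · · v)^[k] f) x = 0) : EqOn f 0 (ball x ρ) := by
  intro y hy
  set v := y - x with hv_def
  rcases eq_or_ne v 0 with hv | hv
  · have hyx : y = x := by rwa [hv_def, sub_eq_zero] at hv
    simpa [hyx] using h 0 0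
  have hvn : 0 < ‖v‖ := norm_pos_iff.2 hv
  have hvρ : ‖v‖ < ρ := by rwa [hv_def, ← dist_eq_norm]
  set R : ℝ := ρ / ‖v‖ with hR_def
  have hR1 : 1 < R := by rw [hR_def, lt_div_iff₀ hvn]; linarith
  -- the slice through `x` in direction `v` is differentiable on `ball 0 R`
  have hsub : ∀ t ∈ ball (0 : ℂ) R, x + t • v ∈ ball x ρ := by
    intro t ht
    rw [mem_ball, dist_zero_right] at ht
    rw [mem_ball, dist_eq_norm, add_sub_cancel_left, norm_smul]
    calc ‖t‖ * ‖v‖ < R * ‖v‖ := by gcongr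
      _ = ρ := by rw [hR_def]; field_simp
  have hd : DifferentiableOn ℂ (fun t : ℂ => f (x + t • v)) (ball 0 R) :=
    (differentiableOn_slice hf x v).mono fun t ht => hρU (hsub t ht)
  have hsum := Complex.hasSum_taylorSeries_on_ball hd (z := 1) (by simpa using hR1)
  have hzero : (fun n : ℕ => (n.factorial : ℂ)⁻¹ • ((1 : ℂ) - 0) ^ n •
      iteratedDeriv n (fun t : ℂ => f (x + t • v)) 0) = fun _ => 0 := by
    funext n
    have h0 : (0 : ℂ) ∈ {t : ℂ | x + t • v ∈ U} := by
      simpa using hρU (mem_ball_self (by linarith [norm_nonneg v] : (0 : ℝ) < ρ))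
    rw [iteratedDeriv_slice_eqOn hf hU x v n h0]
    simp [h v n]
  rw [hzero] at hsum
  have := hsum.unique hasSum_zero
  simpa [hv_def] using this

/-- **Identity principle**, filter form: if all iterated directional derivatives of a holomorphic
`f` vanish at `x ∈ U`, then `f` vanishes on a neighbourhood of `x`. [folklore] -/
theorem eventuallyEq_zero_of_iterate_fderiv_apply_eq_zero {f : E → F} {U : Set E}
    (hf : DifferentiableOn ℂ f U) (hU : IsOpen U) {x : E} (hx : x ∈ U)
    (h : ∀ (v : E) (k : ℕ), ((fderiv ℂ · · v)^[k] f) x = 0) : f =ᶠ[𝓝 x] 0 := by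
  obtain ⟨ρ, hρ, hρU⟩ := Metric.isOpen_iff.1 hU x hx
  exact eventuallyEq_of_mem (ball_mem_nhds x hρ)
    (eqOn_zero_ball_of_iterate_fderiv_apply_eq_zero hf hU hρU h)

/-- Contrapositive of the identity principle: a holomorphic function which does not vanish
identically near `x` has a non-vanishing iterated directional derivative `∂_v^k f (x) ≠ 0`.
[folklore] -/
theorem exists_iterate_fderiv_apply_ne_zero {f : E → F} {U : Set E}
    (hf : DifferentiableOn ℂ f U) (hU : IsOpen U) {x : E} (hx : x ∈ U)
    (h : ¬ f =ᶠ[𝓝 x] 0) : ∃ (v : E) (k : ℕ), ((fderiv ℂ · · v)^[k] f) x ≠ 0 := by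
  by_contra hcon
  push Not at hcon
  exact h (eventuallyEq_zero_of_iterate_fderiv_apply_eq_zero hf hU hx hcon)

end Cauchy

/-! ### Holomorphic straightening of a submersion (implicit function theorem) -/

section Straightening

variable [FiniteDimensional ℂ E] {G : Type*} [NormedAddCommGroup G] [NormedSpace ℂ G]

/-- Linear algebra: a surjective linear map `ℓ : E → G` together with a projection `ψ` of `E`
onto `ker ℓ` gives a linear bijection `(ℓ, ψ) : E → G × ker ℓ`. [folklore] -/
theorem exists_proj_ker_bijective (ℓ : E →L[ℂ] G) (hℓ : Function.Surjective ℓ) :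
    ∃ ψ : E →L[ℂ] ↥(LinearMap.ker (ℓ : E →ₗ[ℂ] G)), Function.Bijective (ℓ.prod ψ) := by
  set K : Submodule ℂ E := LinearMap.ker (ℓ : E →ₗ[ℂ] G) with hK
  obtain ⟨K', hKK'⟩ := K.exists_isCompl
  set ψ := K.projectionOnto K' hKK' with hψ
  have hψK : ∀ w : K, ψ (w : E) = w := fun w => Submodule.projectionOnto_apply_left hKK' w
  refine ⟨LinearMap.toContinuousLinearMap ψ, ?_, ?_⟩
  · intro z z' hzz'
    rw [← sub_eq_zero]
    have hz : (ℓ.prod (LinearMap.toContinuousLinearMap ψ)) (z - z') = 0 := by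
      rw [map_sub, hzz', sub_self]
    have hz' : ℓ (z - z') = 0 ∧ ψ (z - z') = 0 := by
      simpa [Prod.ext_iff] using hz
    have hzK : z - z' ∈ K := hz'.1
    have h1 := hψK ⟨z - z', hzK⟩
    rw [hz'.2] at h1
    exact congrArg Subtype.val h1.symm
  · rintro ⟨c, w⟩
    obtain ⟨z₀, hz₀⟩ := hℓ c
    refine ⟨z₀ - (ψ z₀ : E) + (w : E), ?_⟩
    have h1 : ℓ (ψ z₀ : E) = 0 := (ψ z₀).2
    have h2 : ℓ (w : E) = 0 := w.2
    have h3 : ψ (ψ z₀ : E) = ψ z₀ := hψK _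
    have h4 : ψ (w : E) = w := hψK _
    simp [map_sub, map_add, h1, h2, h3, h4, hz₀]

variable [FiniteDimensional ℂ G] {K : Type*} [NormedAddCommGroup K] [NormedSpace ℂ K]
  [FiniteDimensional ℂ K]

/-- **Holomorphic straightening (implicit function theorem for holomorphic maps).** Let
`g : E → G` be complex-differentiable on an open set `W ∋ a` between finite-dimensional complex
normed spaces, and let `ψ : E → K` be a continuous linear map such that `(dg(a), ψ) : E → G × K` is
bijective (e.g. `K = ker dg(a)` and `ψ` a projection, when `dg(a)` is surjective, see
`exists_proj_ker_bijective`). Then `Φ(z) := (g z, ψ (z - a))` restricts to a biholomorphism from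
an open neighbourhood `S ⊆ W` of `a` onto an open set `T ⊆ G × K` with holomorphic inverse `Ψ`,
and `(dg(z), ψ)` is surjective at every `z ∈ S`. In particular `{g = g a} ∩ S` is the
biholomorphic image `Ψ (({g a} × K) ∩ T)` of an open subset of `K`.
[Chirka, *Complex Analytic Sets*, A2.2] [folklore] -/
theorem exists_straightening {g : E → G} {W : Set E} (hg : DifferentiableOn ℂ g W)
    (hW : IsOpen W) {a : E} (ha : a ∈ W) (ψ : E →L[ℂ] K)
    (hbij : Function.Bijective ((fderiv ℂ g a).prod ψ)) :
    ∃ (S : Set E) (T : Set (G × K)) (Ψ : G × K → E),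
      IsOpen S ∧ a ∈ S ∧ S ⊆ W ∧ IsOpen T ∧ DifferentiableOn ℂ Ψ T ∧
      (∀ z ∈ S, (g z, ψ (z - a)) ∈ T ∧ Ψ (g z, ψ (z - a)) = z) ∧
      (∀ p ∈ T, Ψ p ∈ S ∧ (g (Ψ p), ψ (Ψ p - a)) = p) ∧
      (∀ z ∈ S, Function.Surjective ((fderiv ℂ g z).prod ψ)) := by
  haveI : CompleteSpace E := FiniteDimensional.complete ℂ E
  haveI : CompleteSpace G := FiniteDimensional.complete ℂ G
  haveI : CompleteSpace K := FiniteDimensional.complete ℂ K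
  obtain ⟨Le, hLe⟩ : ∃ Le : E ≃L[ℂ] G × K, (Le : E →L[ℂ] G × K) = (fderiv ℂ g a).prod ψ :=
    ⟨ContinuousLinearEquiv.ofBijective _ (LinearMap.ker_eq_bot.2 hbij.1)
      (LinearMap.range_eq_top.2 hbij.2), ContinuousLinearEquiv.coe_ofBijective _ _ _⟩
  -- the nonlinear straightening map `Φ`
  set Φ : E → G × K := fun z => (g z, ψ (z - a)) with hΦ
  have hΦd : ∀ z ∈ W, HasFDerivAt Φ ((fderiv ℂ g z).prod ψ) z := by
    intro z hz
    have h1 : HasFDerivAt g (fderiv ℂ g z) z := (hg.differentiableAt (hW.mem_nhds hz)).hasFDerivAt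
    have h2 : HasFDerivAt (fun z => ψ (z - a)) ψ z := by
      simpa only [map_sub] using ψ.hasFDerivAt.sub_const (ψ a)
    exact h1.prodMk h2
  have hΦc : ContDiffAt ℂ 1 Φ a := by
    have h1 : ContDiffAt ℂ 1 g a := (contDiffOn_one hg hW).contDiffAt (hW.mem_nhds ha)
    have h2 : ContDiffAt ℂ 1 (fun z => ψ (z - a)) a :=
      (ψ.contDiff.comp (contDiff_id.sub contDiff_const)).contDiffAt
    exact h1.prodMk h2
  have hΦa : HasFDerivAt Φ (Le : E →L[ℂ] G × K) a := hLe ▸ hΦd a ha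
  set Φₕ := hΦc.toOpenPartialHomeomorph Φ hΦa one_ne_zero with hΦₕ
  have haS : a ∈ Φₕ.source := hΦc.mem_toOpenPartialHomeomorph_source hΦa one_ne_zero
  have hΨc : ContDiffAt ℂ 1 Φₕ.symm (Φ a) := hΦc.to_localInverse hΦa one_ne_zero
  -- differentiability of the inverse near `Φ a`
  obtain ⟨T₁, hT₁Ψ, hT₁o, haT₁⟩ : ∃ T₁ : Set (G × K), (∀ p ∈ T₁, DifferentiableAt ℂ Φₕ.symm p) ∧
      IsOpen T₁ ∧ Φ a ∈ T₁ :=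
    eventually_nhds_iff.1 ((hΨc.eventually (by simp)).mono
      fun p (hp : ContDiffAt ℂ 1 Φₕ.symm p) => hp.differentiableAt one_ne_zero)
  set T := (Φₕ.target ∩ Φₕ.symm ⁻¹' W) ∩ T₁ with hT
  have hTo : IsOpen T := (Φₕ.symm.isOpen_inter_preimage hW).inter hT₁o
  set S := Φₕ.source ∩ Φₕ ⁻¹' T with hS
  have hST : ∀ z ∈ S, Φ z ∈ T := fun z hz => hz.2
  have hSW : ∀ z ∈ S, z ∈ W := by
    intro z hz
    have h1 : Φₕ.symm (Φₕ z) ∈ W := (hST z hz).1.2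
    rwa [Φₕ.left_inv hz.1] at h1
  refine ⟨S, T, Φₕ.symm, Φₕ.isOpen_inter_preimage hTo, ?_, hSW, hTo, ?_, ?_, ?_, ?_⟩
  · -- `a ∈ S`
    refine ⟨haS, ?_⟩
    show Φ a ∈ T
    refine ⟨⟨Φₕ.map_source haS, ?_⟩, haT₁⟩
    show Φₕ.symm (Φₕ a) ∈ W
    rwa [Φₕ.left_inv haS]
  · -- `Ψ` is holomorphic on `T`
    exact fun p hp => (hT₁Ψ p hp.2).differentiableWithinAt
  · -- `Ψ ∘ Φ = id` on `S`
    intro z hz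
    exact ⟨hST z hz, Φₕ.left_inv hz.1⟩
  · -- `Φ ∘ Ψ = id` on `T`, and `Ψ` maps `T` into `S`
    intro p hp
    have hp' : p ∈ Φₕ.target := hp.1.1
    have h1 : Φₕ (Φₕ.symm p) = p := Φₕ.right_inv hp'
    refine ⟨⟨Φₕ.map_target hp', ?_⟩, h1⟩
    show Φₕ (Φₕ.symm p) ∈ T
    rwa [h1]
  · -- surjectivity of `(dg(z), ψ)` on `S`
    intro z hz
    have hzT : Φ z ∈ T := hST z hz
    have h1 : HasFDerivAt Φ ((fderiv ℂ g z).prod ψ) (Φₕ.symm (Φ z)) := by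
      rw [show Φₕ.symm (Φ z) = z from Φₕ.left_inv hz.1]
      exact hΦd z (hSW z hz)
    have h2 : HasFDerivAt Φₕ.symm (fderiv ℂ Φₕ.symm (Φ z)) (Φ z) := (hT₁Ψ _ hzT.2).hasFDerivAt
    have h3 := h1.comp _ h2
    have h4 : HasFDerivAt (Φ ∘ Φₕ.symm) (ContinuousLinearMap.id ℂ _) (Φ z) :=
      (hasFDerivAt_id (Φ z)).congr_of_eventuallyEq
        ((Φₕ.eventually_right_inverse' hz.1).mono fun y hy => by
          simpa using (show Φ (Φₕ.symm y) = y from hy))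
    have h5 := h3.unique h4
    intro q
    exact ⟨fderiv ℂ Φₕ.symm (Φ z) q, by simpa using congrArg (fun T : G × K →L[ℂ] G × K => T q) h5⟩

end Straightening

end SCV
end Literature.Analysis.Complex
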